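import Mathlib
import Literature.Analysis.FluidPDE.PoincareHomotopyOperator
import Literature.Analysis.FluidPDE.VectorCalculusProofs
import Literature.Analysis.FluidPDE.AxisymmetricVorticityTransport
import Literature.Analysis.Calculus.HadamardLemma
import Literature.Analysis.FluidPDE.EulerTimeScaling
import Summits.NavierStokesRegularity.NavierStokesRegularity.Theorems.RungBlowupCofinal.CasimirCutRotationInvariance
import Summits.NavierStokesRegularity.NavierStokesRegularity.Theorems.TypeIIInviscidRelaxationColumnarCoreExclusionStreamCutoff
import HarnessLib

/-!
# Crux `MonopoleCoreExclusion` (stmt-NavierStokesRegularity-1965), line `axisymmetric_comparison_flow`: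
# an exactly divergence-free, compactly supported, AXISYMMETRIC cut-off of a divergence-free axisymmetric field

`--supports stmt-NavierStokesRegularity-1965` (helper file; theorems only, no definitions, no `sorry`).

The missing M-item of the (corrected) transfer stub `stub_axisymComparisonFlowOfAX` in the repair censuses of hands
4-g0 / 6-g0 / 6-g1: the azimuthal-average datum (`AzimuthalComparisonDatum.exists_smooth_axisym_azimuthalAverage_close_ball`,
p826992) is smooth, divergence free and exactly axisymmetric but not compactly supported; the standing conjecture
`AxisymmetricSwirlRegularity` wants rapidly decaying data.  Here: a smooth divergence-free axisymmetric `w` on `ℝ³` has,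
for `0 < R < R'`, a smooth divergence-free axisymmetric modification `v = curl (ζ · P)` equal to `w` on `ball 0 R` and
vanishing off `closedBall 0 R'` (`exists_axisym_divFree_cutoff`), where `P = conePotential w` is the tree's cone
(Poincaré homotopy) vector potential (`Literature.Analysis.FluidPDE.conePotential`, Fonda 2018 Thm. 3.31), shown here to
be smooth with `curl P = w` POINTWISE (`curl_conePotential`; the tree had the distributional form
`integral_inner_conePotential_curl`) and axisymmetric with `w` (`isAxisymmetric_conePotential`: rotations about the axis
preserve cross products), and `ζ = φ(‖·‖²)` is a radial plateau cut-off (profile of `…StreamCutoff`).  The same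
construction works for any symmetry by proper rotations.  Nothing here says anything about Navier–Stokes regularity.
-/

noncomputable section

open Set Metric MeasureTheory Function Filter Topology intervalIntegral
open Literature.Analysis Literature.Analysis.Calculus Literature.Analysis.FluidPDE
open scoped InnerProductSpace ContDiff RealInnerProductSpace

namespace Summit.NavierStokesRegularity.NavierStokesRegularity.Theorems

-- the problem directory repeats the summit name (`NavierStokesRegularity/NavierStokesRegularity`)
set_option linter.dupNamespace false

namespace AxisymDivFreeCutoff

open ColumnarComparisonDatum (contDiff_profile profile_eq_one profile_eq_zero)

variable {g : EuclideanSpace ℝ (Fin 3) → EuclideanSpace ℝ (Fin 3)}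

/-! ## §1 The cone potential of a smooth field: smoothness and `curl P = g` pointwise -/

/-- The cone integrand `(x, t) ↦ t • g(t x) × x` is jointly smooth for smooth `g`. [folklore] -/
theorem contDiff_uncurry_coneIntegrand (hg : ContDiff ℝ ∞ g) :
    ContDiff ℝ ∞ (uncurry fun (x : EuclideanSpace ℝ (Fin 3)) (t : ℝ) => coneIntegrand g t x) := by
  have h1 : ContDiff ℝ ∞ fun p : EuclideanSpace ℝ (Fin 3) × ℝ => p.2 • p.1 := contDiff_snd.smul contDiff_fst
  have h2 : ContDiff ℝ ∞ fun p : EuclideanSpace ℝ (Fin 3) × ℝ => g (p.2 • p.1) := hg.comp h1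
  have h3 : ContDiff ℝ ∞ fun p : EuclideanSpace ℝ (Fin 3) × ℝ => crossCLM (g (p.2 • p.1)) p.1 :=
    (crossCLM.contDiff.comp h2).clm_apply contDiff_fst
  have e : (uncurry fun (x : EuclideanSpace ℝ (Fin 3)) (t : ℝ) => coneIntegrand g t x) =
      fun p : EuclideanSpace ℝ (Fin 3) × ℝ => p.2 • crossCLM (g (p.2 • p.1)) p.1 := by
    funext p
    simp [uncurry, coneIntegrand_apply, crossCLM_apply]
  rw [e]
  exact contDiff_snd.smul h3

/-- **The cone potential of a smooth field is smooth** (differentiation under the integral sign). [folklore] -/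
theorem contDiff_conePotential (hg : ContDiff ℝ ∞ g) : ContDiff ℝ ∞ (conePotential g) :=
  contDiff_intervalIntegral (F := fun (x : EuclideanSpace ℝ (Fin 3)) (t : ℝ) => coneIntegrand g t x) (n := ⊤)
    (contDiff_uncurry_coneIntegrand hg) 0 1

/-- **Poincaré lemma, pointwise**: for a smooth divergence-free field `g` on `ℝ³`, `curl (conePotential g) = g`
(Fonda 2018, Thm. 3.31: `curl ∫₀¹ t g(tx) × x dt = ∫₀¹ d/dt [t² g(tx)] dt = g(x)` when `div g = 0`).
[cite: Fonda2018, Thm. 3.31] -/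
theorem curl_conePotential (hg : ContDiff ℝ ∞ g) (hdiv : VectorCalculus.IsDivFree g) (x : EuclideanSpace ℝ (Fin 3)) :
    curl (conePotential g) x = g x := by
  set F : EuclideanSpace ℝ (Fin 3) → ℝ → EuclideanSpace ℝ (Fin 3) := fun x t => coneIntegrand g t x with hF_def
  have hF : ContDiff ℝ ∞ (uncurry F) := contDiff_uncurry_coneIntegrand hg
  have hg1 : ContDiff ℝ 1 g := hg.of_le (by exact_mod_cast le_top)
  have e : conePotential g = fun x => ∫ t in (0 : ℝ)..1, F x t := rfl
  rw [curl_eq_curlCLM, e, fderiv_intervalIntegral_eq_partialFDerivFst hF (by simp) 0 1]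
  have hint : IntervalIntegrable (fun t => partialFDerivFst F x t) volume 0 1 :=
    ((continuous_uncurry_partialFDerivFst hF (by simp)).comp (Continuous.prodMk_right x)).intervalIntegrable _ _
  have step : curlCLM (∫ t in (0 : ℝ)..1, partialFDerivFst F x t) = ∫ t in (0 : ℝ)..1, curlCLM (partialFDerivFst F x t) :=
    (curlCLM.intervalIntegral_comp_comm hint).symm
  rw [step]
  have hid : ∀ t : ℝ, curlCLM (partialFDerivFst F x t) = (2 * t) • g (t • x) + (t ^ 2) • fderiv ℝ g (t • x) x := by
    intro t
    rw [← fderiv_eq_partialFDerivFst hF (by simp) x t]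
    show curlCLM (fderiv ℝ (coneIntegrand g t) x) = _
    rw [← curl_eq_curlCLM, curl_coneIntegrand hg1 t x, hdiv (t • x), mul_zero, zero_smul, sub_zero]
  simp_rw [hid]
  exact integral_deriv_sq_smul_comp_smul hg1 x

/-! ## §2 Axisymmetry of the cone potential -/

open Summit.NavierStokesRegularity.AngularGalerkinLadderCasimirRotation (rotZ_cross)

/-- The cone integrand of an axisymmetric field is axisymmetric. [folklore] -/
theorem coneIntegrand_rotZ (hax : IsAxisymmetric g) (t θ : ℝ) (x : EuclideanSpace ℝ (Fin 3)) :
    coneIntegrand g t (rotZ θ x) = rotZ θ (coneIntegrand g t x) := by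
  rw [coneIntegrand_apply, coneIntegrand_apply, ← rotZ_smul θ t x, hax, ← rotZ_cross, rotZ_smul]

/-- **The cone potential of an axisymmetric field is axisymmetric** (rotations about the axis commute with the
dilations `x ↦ t x` and preserve cross products). [folklore] -/
theorem isAxisymmetric_conePotential (hg : ContDiff ℝ ∞ g) (hax : IsAxisymmetric g) :
    IsAxisymmetric (conePotential g) := by
  intro θ x
  rw [conePotential, conePotential]
  simp_rw [coneIntegrand_rotZ hax, ← rotZL_apply]
  have hint : IntervalIntegrable (fun t => coneIntegrand g t x) volume 0 1 :=
    ((contDiff_uncurry_coneIntegrand hg).continuous.comp (Continuous.prodMk_right x)).intervalIntegrable _ _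
  exact (rotZL θ).intervalIntegral_comp_comm hint

/-! ## §3 The cut-off -/

/-- The radial plateau `ζ = φ(‖·‖²)` is smooth. [folklore] -/
theorem contDiff_radial {φ : ℝ → ℝ} (hφ : ContDiff ℝ ∞ φ) :
    ContDiff ℝ ∞ fun x : EuclideanSpace ℝ (Fin 3) => φ (‖x‖ ^ 2) :=
  hφ.comp (contDiff_norm_sq ℝ)

/-- **Axisymmetric divergence-free compactly supported cut-off.**  Let `w : ℝ³ → ℝ³` be smooth, divergence free and
axisymmetric, and `0 < R < R'`.  Then there is a smooth, divergence-free, axisymmetric `v` with `v = w` on `ball 0 R`,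
`v = 0` off `closedBall 0 R'`, and compact support — namely `v = curl (ζ • conePotential w)` with the radial plateau
`ζ = φ(‖·‖²)`, `φ(ρ) = smoothTransition ((R'² − ρ)/(R'² − R²))`: `curl (ζ P) = ζ w + ∇ζ × P`. [folklore] -/
theorem exists_axisym_divFree_cutoff {w : EuclideanSpace ℝ (Fin 3) → EuclideanSpace ℝ (Fin 3)}
    (hw : ContDiff ℝ ∞ w) (hdiv : VectorCalculus.IsDivFree w) (hax : IsAxisymmetric w)
    {R R' : ℝ} (hR : 0 < R) (hRR' : R < R') :
    ∃ v : EuclideanSpace ℝ (Fin 3) → EuclideanSpace ℝ (Fin 3),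
      ContDiff ℝ ∞ v ∧ VectorCalculus.IsDivFree v ∧ IsAxisymmetric v ∧
      (∀ x ∈ ball (0 : EuclideanSpace ℝ (Fin 3)) R, v x = w x) ∧
      (∀ x, x ∉ closedBall (0 : EuclideanSpace ℝ (Fin 3)) R' → v x = 0) ∧
      HasCompactSupport v := by
  -- the radial plateau
  obtain ⟨φ, hφ⟩ : ∃ φ : ℝ → ℝ, φ = fun ρ => Real.smoothTransition ((R' ^ 2 - ρ) / (R' ^ 2 - R ^ 2)) := ⟨_, rfl⟩
  have hφs : ContDiff ℝ ∞ φ := contDiff_profile hφ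
  set ζ : EuclideanSpace ℝ (Fin 3) → ℝ := fun x => φ (‖x‖ ^ 2) with hζ_def
  have hζs : ContDiff ℝ ∞ ζ := contDiff_radial hφs
  have hζ_one : ∀ x : EuclideanSpace ℝ (Fin 3), ‖x‖ < R → ζ x = 1 := fun x hx =>
    profile_eq_one hφ hR.le hRR' (by nlinarith [norm_nonneg x])
  have hζ_zero : ∀ x : EuclideanSpace ℝ (Fin 3), R' < ‖x‖ → ζ x = 0 := fun x hx =>
    profile_eq_zero hφ hR.le hRR' (by nlinarith [norm_nonneg x, hR.trans hRR'])
  have hζ_rot : ∀ (θ : ℝ) (x : EuclideanSpace ℝ (Fin 3)), ζ (rotZ θ x) = ζ x := fun θ x => by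
    simp only [hζ_def, norm_rotZ]
  -- the potential
  set P := conePotential w with hP_def
  have hPs : ContDiff ℝ ∞ P := contDiff_conePotential hw
  have hPax : IsAxisymmetric P := isAxisymmetric_conePotential hw hax
  set A : EuclideanSpace ℝ (Fin 3) → EuclideanSpace ℝ (Fin 3) := fun x => ζ x • P x with hA_def
  have hAs : ContDiff ℝ ∞ A := hζs.smul hPs
  have hAax : IsAxisymmetric A := fun θ x => by
    show ζ (rotZ θ x) • P (rotZ θ x) = rotZ θ (ζ x • P x)
    rw [hζ_rot, hPax θ x, rotZ_smul]
  -- `A` vanishes off the closed ball, hence has compact support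
  have hA0 : ∀ x, x ∉ closedBall (0 : EuclideanSpace ℝ (Fin 3)) R' → A x = 0 := by
    intro x hx
    rw [mem_closedBall, dist_zero_right, not_le] at hx
    show ζ x • P x = 0
    rw [hζ_zero x hx, zero_smul]
  have hAc : HasCompactSupport A := HasCompactSupport.intro (isCompact_closedBall _ _) hA0
  have htsA : tsupport A ⊆ closedBall 0 R' :=
    closure_minimal (fun x hx => by by_contra h; exact hx (hA0 x h)) isClosed_closedBall
  refine ⟨curl A, ?_, ?_, ?_, ?_, ?_, hasCompactSupport_curl hAc⟩
  · exact contDiff_infty.2 fun n => contDiff_curl (hAs.of_le (by exact_mod_cast le_top))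
  · exact fun x => divergence_curl_eq_zero_holds A (contDiff_infty.1 hAs 2) x
  · exact hAax.curl (hAs.differentiable (by simp))
  · intro x hx
    rw [mem_ball, dist_zero_right] at hx
    have hζd : DifferentiableAt ℝ ζ x := (hζs.differentiable (by simp)) x
    have hPd : DifferentiableAt ℝ P x := (hPs.differentiable (by simp)) x
    have hfz : fderiv ℝ ζ x = 0 := by
      have hev : ζ =ᶠ[𝓝 x] fun _ => (1 : ℝ) := by
        have ho : IsOpen {y : EuclideanSpace ℝ (Fin 3) | ‖y‖ < R} := isOpen_lt continuous_norm continuous_const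
        exact Filter.eventually_of_mem (ho.mem_nhds hx) fun y hy => hζ_one y hy
      rw [hev.fderiv_eq]; simp
    show curl (fun y => ζ y • P y) x = w x
    rw [curl_smul hζd hPd, hfz, hζ_one x hx, one_smul, hP_def, curl_conePotential hw hdiv x]
    simp
  · intro x hx
    exact curl_eq_zero_of_notMem_tsupport fun h => hx (htsA h)

end AxisymDivFreeCutoff

end Summit.NavierStokesRegularity.NavierStokesRegularity.Theorems

end
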